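import Literature.Probability.Percolation.OneArmOSSSCovariance
import Literature.Probability.ODonnellSaksSchrammServedio2005.OSInequality
import HarnessLib

/-!
# Revealment bound for the derivative of a seed-to-target crossing probability (Dewan–Muirhead, Prop. 2.10 / Lemma 2.9)

Source: V. Dewan, S. Muirhead, *Upper bounds on the one-arm exponent for dependent percolation models*, PTRF (2022),
§2: Lemma 2.9 ("there are algorithms determining `Cross_k(R)` such that `max_{e∈B_k^+(R)} Rev(e) ≤ 2P_p[A_1(R)]`":
explore the clusters of a SEED SET — a face of the box — and the revealment of an edge is at most the probability
that one of its endpoints is joined to the seed set) and Prop. 2.10, eq. (2.8)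
(`|∑_{e∈E'} ∂_{p_e} P_p[A]| ≤ √(P_p[A]·E_p|W_{E'}|)/√(p(1−p))` for any algorithm determining `A`), combined as in the
proof of their Prop. 2.2.  The decision tree is the seed-set exploration of Duminil-Copin–Raoufi–Tassion (Ann. of
Math. 189 (2019), §3, proof of Lemma 3.2), formalised in `SeedExploration.lean` as a legal query strategy on the
product cube of a finite edge-labelled graph (`W`, `E`, `edge : W → W → Option E`).

This file: the SEED-TO-TARGET crossing function `𝟙{Z ↔ B}` (`gcross`; some seed vertex joined by an open path to some
target vertex — for `Z = ∂Λ_L`, `B = ∂Λ_N` the annulus crossing), its leaf labels (`labelCross`) with halting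
correctness (`labelCross_eq_of_halt` — no separation hypothesis is needed: at a halting state the open clusters of the
seeds are completely queried), the revealment bound `δ_e ≤ P(a ↔ Z) + P(b ↔ Z)` (`revealment_cross_le`), the
pivotality `P(e pivotal for {Z ↔ B})` (`pivCross`) with `Cov(𝟙{Z↔B}, x_e) = p_e(1−p_e)·P(e pivotal)`
(`sum_wt_gcross_mul_ctr`), `Var 𝟙{Z↔B} = A(1−A)` (`sum_wt_gcross_sub_sq`), and THE BOUND
(`sum_piv_le_sqrt`, O'Donnell–Servedio's inequality `OSInequality.lean` for this tree): for every finite set `J` of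
edge labels and any majorant `R(e) ≥ P(a ↔ Z) + P(b ↔ Z)` of the revealment on `J`,

  `∑_{e∈J} p_e(1−p_e)·P(e pivotal for {Z ↔ B}) ≤ √( A(1−A) · ∑_{e∈J} R(e)·p_e(1−p_e) )`,   `A = P(Z ↔ B)`.

With a homogeneous bias and Russo's formula the left side is `p(1−p)·(d/dp)P_p(Z ↔ B)` restricted to `J`
(Dewan–Muirhead (2.8) with the variance in place of `P[A]`).  The `ℤ^d` instance (annulus crossings, sphere seeds,
the zone split of their Prop. 2.2) is `Summits/CriticalPhenomena/PercolationContinuityZ3/Theorems/…QuantCrossingDerivRevealment.lean`.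
-/

namespace Literature.Probability.Percolation

open Finset Function Literature.Probability.ODonnellSaksSchrammServedio2005
open Literature.Probability.ODonnellSaksSchrammServedio2005.Strategy
open GhostExploration

namespace SeedExploration

variable {W E : Type*} (edge : W → W → Option E)

/-- `Z ↔ B`: some seed vertex is joined by an open path of the input to some target vertex (for a face seed and
the opposite face, Dewan–Muirhead's `Cross_k(R)`; for `Z = ∂Λ_L`, `B = ∂Λ_N` an annulus crossing).
[cite: DewanMuirhead2022, §2 Lemma 2.9 (the events Cross_k(R) determined by exploring from a hyperplane)] -/
def SConn (Z B : Set W) (y : E → Bool) : Prop := ∃ u ∈ Z, ∃ b ∈ B, YReach edge y u b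

open Classical in
/-- The indicator `𝟙{Z ↔ B}` on edge configurations. [cite: DewanMuirhead2022, §2 Lemma 2.9 (algorithms determining Cross_k(R))] -/
noncomputable def gcross (Z B : Set W) (y : E → Bool) : ℝ := if SConn edge Z B y then 1 else 0

open Classical in
/-- Leaf labels of the seed exploration for the target set `B`: `1` if some seed vertex is joined by queried-open
edges to a vertex of `B`, `0` otherwise. [cite: DewanMuirhead2022, §2 proof of Lemma 2.9 (revealing the clusters of the seed hyperplane determines Cross_k(R))] -/
noncomputable def labelCross (Z B : Set W) (σ : E → Option Bool) : ℝ :=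
  if ∃ u ∈ Z, ∃ b ∈ B, SReach edge σ u b then 1 else 0

/-- `gcross ∈ {0,1}`: `|gcross| ≤ 1`. [cite: DewanMuirhead2022, §2 Lemma 2.9 (Cross_k(R) is an event)] -/
theorem gcross_mem (Z B : Set W) (y : E → Bool) : gcross edge Z B y = 0 ∨ gcross edge Z B y = 1 := by
  unfold gcross; split_ifs <;> simp

variable {edge}

/-- HALTING CORRECTNESS: at a halting state of the seed exploration consistent with the input, the label equals
`𝟙{Z ↔ B}` — the open clusters of the seed vertices have been completely queried (no separation hypothesis).
[cite: DewanMuirhead2022, §2 proof of Lemma 2.9 (the exploration from the hyperplane determines Cross_k(R))] -/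
theorem labelCross_eq_of_halt {Z B : Set W} (σ : E → Option Bool) (x : E → Bool) (hc : Consistent σ x)
    (hh : strategy edge Z σ = none) : labelCross edge Z B σ = gcross edge Z B x := by
  unfold strategy at hh
  split_ifs at hh with h
  simp only [not_exists, not_and] at h
  have key : (∃ u ∈ Z, ∃ b ∈ B, SReach edge σ u b) ↔ SConn edge Z B x := by
    constructor
    · rintro ⟨u, hu, b, hb, hub⟩
      exact ⟨u, hu, b, hb, yReach_of_sReach hc hub⟩
    · rintro ⟨u, hu, b, hb, hub⟩
      have h'' : ∀ e, σ e = none → ∀ a b, edge a b = some e → ¬Active edge Z σ a :=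
        fun e he a b hab => h e he a b hab
      exact ⟨u, hu, b, hb, sReach_of_yReach_of_noPending hc h'' hu hub⟩
  unfold labelCross gcross
  by_cases hA : ∃ u ∈ Z, ∃ b ∈ B, SReach edge σ u b
  · rw [if_pos hA, if_pos (key.mp hA)]
  · rw [if_neg hA, if_neg (fun hG => hA (key.mpr hG))]

variable [DecidableEq E]

/-- `𝟙{Z ↔ B}` is increasing in each edge: `gcross(y^{e→0}) ≤ gcross(y^{e→1})`.
[cite: DewanMuirhead2022, §2 (Cross_k(R) is increasing; Russo's formula (2.4))] -/
theorem gcross_update_false_le (Z B : Set W) (y : E → Bool) (e : E) :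
    gcross edge Z B (update y e false) ≤ gcross edge Z B (update y e true) := by
  have hmono : SConn edge Z B (update y e false) → SConn edge Z B (update y e true) := by
    rintro ⟨u, hu, b, hb, hr⟩
    refine ⟨u, hu, b, hb, yReach_mono (fun e' he' => ?_) hr⟩
    by_cases hee : e' = e
    · subst hee; simp at he'
    · rwa [update_of_ne hee] at he' ⊢
  unfold gcross
  by_cases hf : SConn edge Z B (update y e false)
  · rw [if_pos hf, if_pos (hmono hf)]
  · rw [if_neg hf]; split_ifs <;> norm_num

variable [Fintype E]

open Classical in
/-- REVEALMENT BOUND for the crossing labels: if the label `e` is carried by at most the pair `{a₀, b₀}`, then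
`δ_e ≤ P(a₀ ↔ Z) + P(b₀ ↔ Z)` ("the revealments … are bounded by `P_p[e ↔ seed]`").
[cite: DewanMuirhead2022, §2 Lemma 2.9 (Rev(e) ≤ P_p[e ↔ hyperplane] ≤ 2P_p[A_1(R)])] -/
theorem revealment_cross_le (p : E → ℝ) (h0 : ∀ i, 0 ≤ p i) (h1 : ∀ i, p i ≤ 1) (Z B : Set W) (e : E)
    (a₀ b₀ : W) (hends : ∀ a b, edge a b = some e → a = a₀ ∨ a = b₀) :
    revealment p (strategy edge Z) (labelCross edge Z B) e
      ≤ seedProb edge p Z a₀ + seedProb edge p Z b₀ := by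
  have h := revealment_le h0 h1 (strategy edge Z) (labelCross edge Z B) e
    (fun x => SeedConn edge Z x a₀ ∨ SeedConn edge Z x b₀) (fun σ x hc hq => by
      obtain ⟨a, b, hab, hg⟩ := seedConn_of_query hc hq
      rcases hends a b hab with rfl | rfl
      · exact Or.inl hg
      · exact Or.inr hg)
  refine h.trans ?_
  unfold seedProb
  rw [← Finset.sum_add_distrib]
  refine Finset.sum_le_sum fun x _ => ?_
  rw [← mul_add]
  refine mul_le_mul_of_nonneg_left ?_ (wt_nonneg h0 h1 x)
  by_cases ha : SeedConn edge Z x a₀ <;> by_cases hb : SeedConn edge Z x b₀ <;> simp [ha, hb]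

/-- An edge label carried by no pair is never queried: `δ_e ≤ 0`.
[cite: DewanMuirhead2022, §2 Lemma 2.9 (only edges of the graph are revealed)] -/
theorem revealment_cross_le_zero (p : E → ℝ) (h0 : ∀ i, 0 ≤ p i) (h1 : ∀ i, p i ≤ 1) (Z B : Set W) (e : E)
    (hno : ∀ a b, edge a b ≠ some e) :
    revealment p (strategy edge Z) (labelCross edge Z B) e ≤ 0 := by
  have h := revealment_le h0 h1 (strategy edge Z) (labelCross edge Z B) e (fun _ => False)
    (fun σ x hc hq => by
      obtain ⟨a, b, hab, _⟩ := seedConn_of_query hc hq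
      exact hno a b hab)
  simpa using h

variable (edge) in
/-- `P(e pivotal for {Z ↔ B}) = E[𝟙(y^{e→1}) − 𝟙(y^{e→0})]` (weighted by the product law of the other edges).
[cite: DewanMuirhead2022, §2 eq. (2.4) (Russo's formula: the derivative is the sum of pivotal probabilities)] -/
noncomputable def pivCross (p : E → ℝ) (Z B : Set W) (e : E) : ℝ :=
  ∑ y, wt p y * (gcross edge Z B (update y e true) - gcross edge Z B (update y e false))

/-- `P(e pivotal) ≥ 0`. [cite: DewanMuirhead2022, §2 eq. (2.4) (pivotal probabilities)] -/
theorem pivCross_nonneg {p : E → ℝ} (h0 : ∀ i, 0 ≤ p i) (h1 : ∀ i, p i ≤ 1) (Z B : Set W) (e : E) :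
    0 ≤ pivCross edge p Z B e :=
  Finset.sum_nonneg fun y _ => mul_nonneg (wt_nonneg h0 h1 y) (sub_nonneg.2 (gcross_update_false_le Z B y e))

/-- `Cov(𝟙{Z ↔ B}, x_e) = p_e(1−p_e)·P(e pivotal)`: `E[𝟙{Z↔B}·(𝟙[x_e] − p_e)] = p_e(1−p_e)·pivCross`.
[cite: DewanMuirhead2022, §2 eq. (2.4) and Prop. 2.10 (∂_{p_e} P_p[A])] -/
theorem sum_wt_gcross_mul_ctr (p : E → ℝ) (Z B : Set W) (e : E) :
    ∑ y, wt p y * (gcross edge Z B y * ctr p e y) = p e * (1 - p e) * pivCross edge p Z B e :=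
  sum_wt_mul_ctr_eq p e (gcross edge Z B)

/-- `Var 𝟙{Z ↔ B} = A(1 − A)`, `A = P(Z ↔ B)`. [cite: DewanMuirhead2022, §2 Prop. 2.10 (P[A] in the bound; Bernoulli variance)] -/
theorem sum_wt_gcross_sub_sq (p : E → ℝ) (Z B : Set W) :
    ∑ y, wt p y * (gcross edge Z B y - ∑ z, wt p z * gcross edge Z B z) ^ 2
      = (∑ y, wt p y * gcross edge Z B y) * (1 - ∑ y, wt p y * gcross edge Z B y) := by
  set A : ℝ := ∑ y, wt p y * gcross edge Z B y with hA
  have hsq : ∀ y, gcross edge Z B y ^ 2 = gcross edge Z B y := by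
    intro y; rcases gcross_mem edge Z B y with h | h <;> simp [h]
  have : ∀ y, wt p y * (gcross edge Z B y - A) ^ 2
      = wt p y * gcross edge Z B y * (1 - 2 * A) + wt p y * A ^ 2 := by
    intro y
    have := hsq y
    calc wt p y * (gcross edge Z B y - A) ^ 2
        = wt p y * (gcross edge Z B y ^ 2 - 2 * A * gcross edge Z B y + A ^ 2) := by ring
      _ = _ := by rw [this]; ring
  simp_rw [this]
  rw [Finset.sum_add_distrib, ← Finset.sum_mul, ← Finset.sum_mul, sum_wt, ← hA]
  ring

/-- **THE REVEALMENT BOUND FOR THE DERIVATIVE OF A SEED-TO-TARGET CROSSING** (Dewan–Muirhead Prop. 2.10 (2.8) with the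
seed-exploration tree of Lemma 2.9, variance form).  Edge labels with unique endpoint pairs, biases in `[0,1]`, a finite
set `J` of labels and `R ≥ 0` with `R(e) ≥ P(a ↔ Z) + P(b ↔ Z)` for every `e = ab ∈ J`; then with `A = P(Z ↔ B)`,
`∑_{e∈J} p_e(1−p_e)·P(e pivotal for {Z ↔ B}) ≤ √( A(1−A) · ∑_{e∈J} R(e)·p_e(1−p_e) )`.
[cite: DewanMuirhead2022, Prop. 2.10 eq. (2.8) and Lemma 2.9] [cite: ODonnell2014, §8.6 OS Inequality] -/
theorem sum_piv_le_sqrt (hends : ∀ e a b a' b', edge a b = some e → edge a' b' = some e → a' = a ∨ a' = b)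
    (p : E → ℝ) (h0 : ∀ e, 0 ≤ p e) (h1 : ∀ e, p e ≤ 1) (Z B : Set W) (J : Finset E) {R : E → ℝ}
    (hR0 : ∀ e, 0 ≤ R e) (hR : ∀ e ∈ J, ∀ a b, edge a b = some e → seedProb edge p Z a + seedProb edge p Z b ≤ R e) :
    ∑ e ∈ J, p e * (1 - p e) * pivCross edge p Z B e
      ≤ Real.sqrt ((∑ y, wt p y * gcross edge Z B y) * (1 - ∑ y, wt p y * gcross edge Z B y)
          * ∑ e ∈ J, R e * (p e * (1 - p e))) := by
  -- OS for the seed-exploration strategy computing `gcross`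
  have os := os_sum_cov_le_strategy p h0 h1 (strategy_legal edge Z) (labelCross edge Z B)
    (fun σ x hc hh => labelCross_eq_of_halt σ x hc hh) J
  have hlhs : ∑ e ∈ J, p e * (1 - p e) * pivCross edge p Z B e
      = ∑ e ∈ J, ∑ y, wt p y * (gcross edge Z B y * ctr p e y) :=
    Finset.sum_congr rfl fun e _ => (sum_wt_gcross_mul_ctr p Z B e).symm
  rw [hlhs]
  refine os.trans (Real.sqrt_le_sqrt ?_)
  rw [sum_wt_gcross_sub_sq]
  have hA0 : 0 ≤ ∑ y, wt p y * gcross edge Z B y :=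
    Finset.sum_nonneg fun y _ => mul_nonneg (wt_nonneg h0 h1 y) (by rcases gcross_mem edge Z B y with h | h <;> simp [h])
  have hA1 : ∑ y, wt p y * gcross edge Z B y ≤ 1 := by
    calc ∑ y, wt p y * gcross edge Z B y ≤ ∑ y, wt p y * 1 :=
          Finset.sum_le_sum fun y _ => mul_le_mul_of_nonneg_left
            (by rcases gcross_mem edge Z B y with h | h <;> simp [h]) (wt_nonneg h0 h1 y)
      _ = 1 := by simp [sum_wt]
  refine mul_le_mul_of_nonneg_left ?_ (mul_nonneg hA0 (by linarith))
  refine Finset.sum_le_sum fun e he => mul_le_mul_of_nonneg_right ?_ (mul_nonneg (h0 e) (by linarith [h1 e]))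
  by_cases hex : ∃ a b, edge a b = some e
  · obtain ⟨a₀, b₀, hab⟩ := hex
    exact (revealment_cross_le p h0 h1 Z B e a₀ b₀ (fun a b hab' => hends e a₀ b₀ a b hab hab')).trans
      (hR e he a₀ b₀ hab)
  · push Not at hex
    exact (revealment_cross_le_zero p h0 h1 Z B e hex).trans (hR0 e)

end SeedExploration

end Literature.Probability.Percolation
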